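import Summits.Ventures.LatticeQCDFlow.Scoring.ChainTauIntEmpiricalVariance
import Summits.Ventures.LatticeQCDFlow.Scoring.ChainScorerTauIntCLT
import Summits.Ventures.LatticeQCDFlow.Scoring.ChainLagProductGaussianLimit

/-!
# THE FULLY EMPIRICAL STUDENTISED LAW OF WHAT SCORER A PRINTS, ON MARKOV-CHAIN DATA: with scorer A's own
# `τ̂^A_W = tauIntWindow (rhoHat (f ∘ X) N) W` and the data-only variance estimate `σ̂²_{A,N}` of
# `Scoring/ChainTauIntEmpiricalVariance`, `√N (τ̂^A_W − τ_W) / σ̂_{A,N} ⇒ N(0, 1)` from EVERY initial law,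
# and the interval `τ̂^A_W ± z σ̂_{A,N}/√N` has asymptotically EXACT coverage

HONEST FRAMING: exact (Metropolis-corrected) sampling algorithms for lattice gauge theory;
figures of merit are autocorrelation/cost numbers at stated couplings and volumes; no
continuum-physics claim.

Venture `LatticeQCDFlow` (cell pub-lqcd), sub-topic `Scoring`; FANOUT row 16 (`su2-base`), GEN-10.
NEW WORK of the cell, not a published result; no definition is introduced; nothing is cited as a fact
(Slutsky's lemma and the portmanteau theorem from Mathlib — NAMED ONLY).  THE END OF THE LAW-OF-THE-ERROR
PACKET FOR CHAIN DATA: every quantity in the statement is a function of the observed values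
`f(X_0), …, f(X_{N+W})` (scorer A's mean-centred `1/(N−t)` autocovariances `gammaHat`, its `τ̂^A_W`, the
empirically centred lag products) except the estimand `τ_W` and the nominal level.  Inputs: GEN-9's CLT for
scorer A's exact statistic on chain data (`Scoring/ChainScorerTauIntCLT`: mean subtraction and `1/(N−t)`
are `o_P(N^{-1/2})` along the chain) with GEN-9's realised Gaussian limit
(`Scoring/ChainLagProductGaussianLimit`: `Z ∼ N(0, Σ)`, `⟪ℓ, Z⟫ ∼ N(0, σ²_ℓ)`), GEN-10's fully empirical
variance estimate (`Scoring/ChainTauIntEmpiricalVariance`: `σ̂²_{A,N} → σ²_ℓ` in probability, truncations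
`K_N → ∞`, `K_N³/N → 0`), and row 13's plug-in coverage lemma.  For every bounded observable with
`C(0) ≠ 0` and `σ²_ℓ > 0`, along every chain with a Doeblin power, from EVERY initial law.

## Content (`κ` Markov, `π` invariant, `(nHit κ m)(z, ·) ≥ ε ν` for all `z`, `ε ≠ 0`, `0 < m`;
## `|f| ≤ C` measurable, `f̄ = f − ∫ f dπ`, `C(t) = autocov κ π f̄ t`, `C(0) ≠ 0`; `τ_W = tauIntWindow (C/C(0)) W`;
## `m_N = sampleMean (f ∘ X) N`, `p̃^s_i = (f(X_i) − m_N)(f(X_{i+s}) − m_N)`,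
## `ℓ̂^A_N = tauHatGrad W (gammaHat (f ∘ X) N t)_t`, `σ̂²_{A,N} = Σ_s Σ_t ℓ̂^A_s ℓ̂^A_t gammaCross p̃^s p̃^t N K_N`;
## `σ²_ℓ = Σ_s Σ_t ℓ_s ℓ_t Σ(s,t)`; `K_N → ∞`, `K_N³/N → 0`; `μ₀` ANY initial law)

* `measurable_chain_empTauIntVarHat` — `σ̂²_{A,N}` is a measurable function of the path;
  **`chain_invSqrt_empTauIntVarHat_tendstoInMeasure_of_nHit`** — `(√σ̂²_{A,N})⁻¹ → (√σ²_ℓ)⁻¹` in measure.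
* **`tendstoInDistribution_chain_scorer_studentized_tauIntWindow_of_nHit`** — THE STUDENTISED CLT:
  `TendstoInDistribution (N ↦ √N (τ̂^A_W − τ_W) · (√σ̂²_{A,N})⁻¹) atTop id P_{μ₀} (gaussianReal 0 1)`.
* **`tendsto_measure_chain_scorer_studentized_tauIntWindow_le_of_nHit`** — EXACT ASYMPTOTIC COVERAGE
  (`z > 0`): `P_{μ₀}{|√N (τ̂^A_W − τ_W) (√σ̂²_{A,N})⁻¹| ≤ z} → gaussianReal 0 1 (Icc (−z) z)`;
  `…_of_minorised` — the one-step certificate shape `κ(z, ·) ≥ ε ν`.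

NOT CLAIMED: the data-chosen window (GEN-9's `ChainScorerDataWindowCLT` transfers fixed-window laws to
scorer B's selector; composing it with this file is not typed here); `σ²_ℓ > 0` for a given `f`;
finite-`N` coverage or rates; unbounded `f`; any number about row 16's chains.
-/

noncomputable section

open MeasureTheory ProbabilityTheory Filter Finset Preorder WithLp Set
open scoped ENNReal NNReal Topology RealInnerProductSpace
open Summit.Ventures.LatticeQCDFlow.Exactness Summit.Ventures.LatticeQCDFlow.Exactness.GeneralNCMC

namespace Summit.Ventures.LatticeQCDFlow.Scoring

variable {S : Type*} [MeasurableSpace S]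

section Chain

variable (κ : Kernel S S) [IsMarkovKernel κ] (W : ℕ) {π : Measure S} [IsProbabilityMeasure π]
  {ν : Measure S} [IsProbabilityMeasure ν] {ε : ℝ≥0∞} {m : ℕ}

/-- Measurability of the coordinates of scorer A's own gradient estimate `ℓ̂^A_N`. -/
theorem measurable_chain_scorer_tauHatGrad {f : S → ℝ} (hf : Measurable f) (N : ℕ) (i : Fin (W + 1)) :
    Measurable fun x : ℕ → S =>
      tauHatGrad W (toLp 2 fun u : Fin (W + 1) => gammaHat (fun j => f (x j)) N u) i := by
  have hGm : ∀ u, Measurable fun x : ℕ → S => gammaHat (fun j => f (x j)) N u := fun u =>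
    measurable_gammaHat_series (u := fun j (x : ℕ → S) => f (x j))
      (fun j => hf.comp (measurable_pi_apply j)) N u
  simp only [tauHatGrad_coord]
  by_cases hi : i = 0
  · simp only [hi, if_true]
    exact (Finset.measurable_sum _ fun t _ => hGm _).neg.div ((hGm 0).pow_const 2)
  · simp only [hi, if_false]
    exact measurable_const.div (hGm 0)

/-- `σ̂²_{A,N}` is a measurable function of the path. -/
theorem measurable_chain_empTauIntVarHat {f : S → ℝ} (hf : Measurable f) (N K : ℕ) :
    Measurable fun x : ℕ → S => ∑ s : Fin (W + 1), ∑ t : Fin (W + 1),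
        tauHatGrad W (toLp 2 fun u : Fin (W + 1) => gammaHat (fun j => f (x j)) N u) s
          * tauHatGrad W (toLp 2 fun u : Fin (W + 1) => gammaHat (fun j => f (x j)) N u) t
          * gammaCross
              (fun i => (f (x i) - sampleMean (fun j => f (x j)) N)
                * (f (x (i + s)) - sampleMean (fun j => f (x j)) N))
              (fun i => (f (x i) - sampleMean (fun j => f (x j)) N)
                * (f (x (i + t)) - sampleMean (fun j => f (x j)) N)) N K := by
  have hmN : Measurable fun x : ℕ → S => sampleMean (fun j => f (x j)) N :=
    measurable_sampleMean_series (u := fun j (x : ℕ → S) => f (x j))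
      (fun j => hf.comp (measurable_pi_apply j)) N
  have hXm : ∀ i : ℕ, Measurable fun x : ℕ → S => f (x i) - sampleMean (fun j => f (x j)) N := fun i =>
    (hf.comp (measurable_pi_apply i)).sub hmN
  have hG : ∀ s t : Fin (W + 1), Measurable fun x : ℕ → S =>
      gammaCross
        (fun i => (f (x i) - sampleMean (fun j => f (x j)) N)
          * (f (x (i + s)) - sampleMean (fun j => f (x j)) N))
        (fun i => (f (x i) - sampleMean (fun j => f (x j)) N)
          * (f (x (i + t)) - sampleMean (fun j => f (x j)) N)) N K := fun s t =>
    measurable_gammaCross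
      (u := fun (i : ℕ) (x : ℕ → S) => (f (x i) - sampleMean (fun j => f (x j)) N)
        * (f (x (i + s)) - sampleMean (fun j => f (x j)) N))
      (v := fun (i : ℕ) (x : ℕ → S) => (f (x i) - sampleMean (fun j => f (x j)) N)
        * (f (x (i + t)) - sampleMean (fun j => f (x j)) N))
      (fun i => (hXm i).mul (hXm (i + s))) (fun i => (hXm i).mul (hXm (i + t))) N K
  have hL : ∀ s : Fin (W + 1), Measurable fun x : ℕ → S =>
      tauHatGrad W (toLp 2 fun u : Fin (W + 1) => gammaHat (fun j => f (x j)) N u) s := fun s =>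
    measurable_chain_scorer_tauHatGrad W hf N s
  have hLLG : ∀ s t : Fin (W + 1), Measurable fun x : ℕ → S =>
      tauHatGrad W (toLp 2 fun u : Fin (W + 1) => gammaHat (fun j => f (x j)) N u) s
        * tauHatGrad W (toLp 2 fun u : Fin (W + 1) => gammaHat (fun j => f (x j)) N u) t
        * gammaCross
            (fun i => (f (x i) - sampleMean (fun j => f (x j)) N)
              * (f (x (i + s)) - sampleMean (fun j => f (x j)) N))
            (fun i => (f (x i) - sampleMean (fun j => f (x j)) N)
              * (f (x (i + t)) - sampleMean (fun j => f (x j)) N)) N K := fun s t =>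
    ((hL s).mul (hL t)).mul (hG s t)
  exact Finset.measurable_sum _ fun s _ => Finset.measurable_sum _ fun t _ => hLLG s t

/-- **The empirical plug-in scale converges in probability**: for `σ²_ℓ > 0`,
`(√σ̂²_{A,N})⁻¹ → (√σ²_ℓ)⁻¹` in `P_{μ₀}`-measure, from every initial law. -/
theorem chain_invSqrt_empTauIntVarHat_tendstoInMeasure_of_nHit (hπ : Kernel.Invariant κ π) (hε : ε ≠ 0)
    (hmin : ∀ z, ε • ν ≤ nHit κ m z) (hm : 0 < m)
    {f : S → ℝ} (hf : Measurable f) {C : ℝ} (hC : ∀ z, |f z| ≤ C)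
    (hσ : autocov κ π (fun z => f z - ∫ z', f z' ∂π) 0 ≠ 0)
    (hpos : 0 < ∑ s : Fin (W + 1), ∑ t : Fin (W + 1),
        tauHatGrad W (toLp 2 fun u : Fin (W + 1) => autocov κ π (fun z => f z - ∫ z', f z' ∂π) u) s
          * tauHatGrad W (toLp 2 fun u : Fin (W + 1) => autocov κ π (fun z => f z - ∫ z', f z' ∂π) u) t
          * chainLagACov κ π (fun z => f z - ∫ z', f z' ∂π) W s t)
    {K : ℕ → ℕ} (hK : Tendsto K atTop atTop) (hK3 : Tendsto (fun N => (K N : ℝ) ^ 3 / N) atTop (𝓝 0))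
    (μ₀ : Measure S) [IsProbabilityMeasure μ₀] :
    TendstoInMeasure (Kernel.trajMeasure (X := fun _ : ℕ => S) μ₀
        (fun n : ℕ => κ.comap (fun hh : (i : ↥(Finset.Iic n)) → S => hh ⟨n, Finset.mem_Iic.2 le_rfl⟩)
          (measurable_pi_apply _)))
      (fun (N : ℕ) (x : ℕ → S) => (Real.sqrt (∑ s : Fin (W + 1), ∑ t : Fin (W + 1),
        tauHatGrad W (toLp 2 fun u : Fin (W + 1) => gammaHat (fun j => f (x j)) N u) s
          * tauHatGrad W (toLp 2 fun u : Fin (W + 1) => gammaHat (fun j => f (x j)) N u) t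
          * gammaCross
              (fun i => (f (x i) - sampleMean (fun j => f (x j)) N)
                * (f (x (i + s)) - sampleMean (fun j => f (x j)) N))
              (fun i => (f (x i) - sampleMean (fun j => f (x j)) N)
                * (f (x (i + t)) - sampleMean (fun j => f (x j)) N)) N (K N)))⁻¹)
      atTop (fun _ => (Real.sqrt (∑ s : Fin (W + 1), ∑ t : Fin (W + 1),
        tauHatGrad W (toLp 2 fun u : Fin (W + 1) => autocov κ π (fun z => f z - ∫ z', f z' ∂π) u) s
          * tauHatGrad W (toLp 2 fun u : Fin (W + 1) => autocov κ π (fun z => f z - ∫ z', f z' ∂π) u) t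
          * chainLagACov κ π (fun z => f z - ∫ z', f z' ∂π) W s t))⁻¹) := by
  have hcons := chain_empTauIntVarHat_tendstoInMeasure_of_nHit κ W hπ hε hmin hm hf hC hσ hK hK3 μ₀
  have hsq : ContinuousAt (fun v : ℝ => (Real.sqrt v)⁻¹) (∑ s : Fin (W + 1), ∑ t : Fin (W + 1),
      tauHatGrad W (toLp 2 fun u : Fin (W + 1) => autocov κ π (fun z => f z - ∫ z', f z' ∂π) u) s
        * tauHatGrad W (toLp 2 fun u : Fin (W + 1) => autocov κ π (fun z => f z - ∫ z', f z' ∂π) u) t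
        * chainLagACov κ π (fun z => f z - ∫ z', f z' ∂π) W s t) :=
    Real.continuous_sqrt.continuousAt.inv₀ (Real.sqrt_pos.2 hpos).ne'
  exact tendstoInMeasure_comp_continuousAt (g := fun v : ℝ => (Real.sqrt v)⁻¹) hcons hsq
    (fun N => (measurable_chain_empTauIntVarHat W hf N (K N)).sqrt.inv)

/-- **THE FULLY EMPIRICAL STUDENTISED CENTRAL LIMIT THEOREM FOR SCORER A's WINDOWED `τ_int` ON
MARKOV-CHAIN DATA, FROM EVERY INITIAL LAW.**  `κ` Markov with invariant probability `π`,
`(nHit κ m)(z, ·) ≥ ε ν` for all `z` (`ε ≠ 0`, `0 < m`); `|f| ≤ C` measurable, `f̄ = f − ∫ f dπ`,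
`C(0) ≠ 0`, `σ²_ℓ > 0`; truncations `K_N → ∞`, `K_N³/N → 0`.  Then for EVERY initial law `μ₀`, under
`P_{μ₀}`:  `√N (τ̂^A_W − τ_W) · (√σ̂²_{A,N})⁻¹ ⇒ N(0, 1)`, `τ̂^A_W = tauIntWindow (rhoHat (f ∘ X) N) W` scorer
A's printed value (the canonical variable `id` on `(ℝ, gaussianReal 0 1)`). -/
theorem tendstoInDistribution_chain_scorer_studentized_tauIntWindow_of_nHit (hπ : Kernel.Invariant κ π)
    (hε : ε ≠ 0) (hmin : ∀ z, ε • ν ≤ nHit κ m z) (hm : 0 < m)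
    {f : S → ℝ} (hf : Measurable f) {C : ℝ} (hC : ∀ z, |f z| ≤ C)
    (hσ : autocov κ π (fun z => f z - ∫ z', f z' ∂π) 0 ≠ 0)
    (hpos : 0 < ∑ s : Fin (W + 1), ∑ t : Fin (W + 1),
        tauHatGrad W (toLp 2 fun u : Fin (W + 1) => autocov κ π (fun z => f z - ∫ z', f z' ∂π) u) s
          * tauHatGrad W (toLp 2 fun u : Fin (W + 1) => autocov κ π (fun z => f z - ∫ z', f z' ∂π) u) t
          * chainLagACov κ π (fun z => f z - ∫ z', f z' ∂π) W s t)
    {K : ℕ → ℕ} (hK : Tendsto K atTop atTop) (hK3 : Tendsto (fun N => (K N : ℝ) ^ 3 / N) atTop (𝓝 0))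
    (μ₀ : Measure S) [IsProbabilityMeasure μ₀]
    [IsProbabilityMeasure (Kernel.trajMeasure (X := fun _ : ℕ => S) μ₀
        (fun n : ℕ => κ.comap (fun hh : (i : ↥(Finset.Iic n)) → S => hh ⟨n, Finset.mem_Iic.2 le_rfl⟩)
          (measurable_pi_apply _)))] :
    TendstoInDistribution (fun (N : ℕ) (x : ℕ → S) =>
        Real.sqrt N
          * (tauIntWindow (rhoHat (fun i => f (x i)) N) W
            - tauIntWindow (fun t => autocov κ π (fun z => f z - ∫ z', f z' ∂π) t
                / autocov κ π (fun z => f z - ∫ z', f z' ∂π) 0) W)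
          * (Real.sqrt (∑ s : Fin (W + 1), ∑ t : Fin (W + 1),
            tauHatGrad W (toLp 2 fun u : Fin (W + 1) => gammaHat (fun j => f (x j)) N u) s
              * tauHatGrad W (toLp 2 fun u : Fin (W + 1) => gammaHat (fun j => f (x j)) N u) t
              * gammaCross
                  (fun i => (f (x i) - sampleMean (fun j => f (x j)) N)
                    * (f (x (i + s)) - sampleMean (fun j => f (x j)) N))
                  (fun i => (f (x i) - sampleMean (fun j => f (x j)) N)
                    * (f (x (i + t)) - sampleMean (fun j => f (x j)) N)) N (K N)))⁻¹)
      atTop id (fun _ => Kernel.trajMeasure (X := fun _ : ℕ => S) μ₀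
        (fun n : ℕ => κ.comap (fun hh : (i : ↥(Finset.Iic n)) → S => hh ⟨n, Finset.mem_Iic.2 le_rfl⟩)
          (measurable_pi_apply _))) (gaussianReal 0 1) := by
  obtain ⟨hgm, hgC, -⟩ := centred_observable_bounds π hf hC
  set σ2 := ∑ s : Fin (W + 1), ∑ t : Fin (W + 1),
      tauHatGrad W (toLp 2 fun u : Fin (W + 1) => autocov κ π (fun z => f z - ∫ z', f z' ∂π) u) s
        * tauHatGrad W (toLp 2 fun u : Fin (W + 1) => autocov κ π (fun z => f z - ∫ z', f z' ∂π) u) t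
        * chainLagACov κ π (fun z => f z - ∫ z', f z' ∂π) W s t with hσ2
  -- GEN-9's fixed-window law with the concrete limit `Z ∼ N(0, Σ)`, and the law of `⟪ℓ, Z⟫`
  obtain ⟨hZm, hZ⟩ := chain_gaussianLimit_realised κ W hπ hε hmin hm hgm hgC
  have hclt := tendstoInDistribution_chain_scorer_tauIntWindow_of_nHit κ hπ hε hmin hm hf hC W hσ μ₀ hZm hZ
  have hY := hasLaw_chain_tauIntWindow_limit_quadForm κ W hπ hε hmin hm hgm hgC
    (toLp 2 fun t : Fin (W + 1) => autocov κ π (fun z => f z - ∫ z', f z' ∂π) t)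
  rw [← hσ2] at hY
  -- the plug-in scale
  have hB := chain_invSqrt_empTauIntVarHat_tendstoInMeasure_of_nHit κ W hπ hε hmin hm hf hC hσ hpos hK hK3 μ₀
  have hBm := fun N => (measurable_chain_empTauIntVarHat W hf N (K N)).sqrt.inv
  have hXB := hclt.continuous_comp_prodMk_of_tendstoInMeasure_const
    (g := fun p : ℝ × ℝ => p.1 * p.2) (by fun_prop) hB (fun N => (hBm N).aemeasurable)
  -- identify the limit law `⟪ℓ, Z⟫ · (√σ²)⁻¹ ∼ N(0, 1)`
  have hb2 : NNReal.mk (((Real.sqrt σ2)⁻¹) ^ 2) (sq_nonneg _) * σ2.toNNReal = 1 := by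
    apply NNReal.eq
    rw [NNReal.coe_mul, NNReal.coe_mk, Real.coe_toNNReal _ hpos.le, NNReal.coe_one, inv_pow,
      Real.sq_sqrt hpos.le, inv_mul_cancel₀ hpos.ne']
  have hlaw : HasLaw (fun z : EuclideanSpace ℝ (Fin (W + 1)) =>
      ⟪tauHatGrad W (toLp 2 fun t : Fin (W + 1) => autocov κ π (fun z => f z - ∫ z', f z' ∂π) t), z⟫
        * (Real.sqrt σ2)⁻¹) (gaussianReal 0 1)
      (multivariateGaussian 0 (Matrix.of fun s t : Fin (W + 1) =>
        chainLagACov κ π (fun z => f z - ∫ z', f z' ∂π) W s t)) := by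
    have h := gaussianReal_mul_const hY (Real.sqrt σ2)⁻¹
    rwa [mul_zero, hb2] at h
  refine ⟨hXB.forall_aemeasurable, aemeasurable_id, ?_⟩
  have ht := hXB.tendsto
  have heq : (⟨(gaussianReal 0 1).map id, Measure.isProbabilityMeasure_map aemeasurable_id⟩ :
      ProbabilityMeasure ℝ)
      = ⟨(multivariateGaussian 0 (Matrix.of fun s t : Fin (W + 1) =>
          chainLagACov κ π (fun z => f z - ∫ z', f z' ∂π) W s t)).map
          (fun z : EuclideanSpace ℝ (Fin (W + 1)) =>
            ⟪tauHatGrad W (toLp 2 fun t : Fin (W + 1) => autocov κ π (fun z => f z - ∫ z', f z' ∂π) t), z⟫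
              * (Real.sqrt σ2)⁻¹),
        Measure.isProbabilityMeasure_map hXB.aemeasurable_limit⟩ := by
    apply Subtype.ext
    show (gaussianReal 0 1).map id = (multivariateGaussian 0 (Matrix.of fun s t : Fin (W + 1) =>
        chainLagACov κ π (fun z => f z - ∫ z', f z' ∂π) W s t)).map
      (fun z : EuclideanSpace ℝ (Fin (W + 1)) =>
        ⟪tauHatGrad W (toLp 2 fun t : Fin (W + 1) => autocov κ π (fun z => f z - ∫ z', f z' ∂π) t), z⟫
          * (Real.sqrt σ2)⁻¹)
    rw [Measure.map_id, hlaw.map_eq]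
  rw [heq]
  exact ht

/-- **THE FULLY EMPIRICAL STUDENTISED ERROR BAR OF SCORER A's `τ̂_W` HAS ASYMPTOTICALLY EXACT COVERAGE ON
CHAIN DATA, FROM EVERY INITIAL LAW.**  Under the hypotheses of
`tendstoInDistribution_chain_scorer_studentized_tauIntWindow_of_nHit`, for every `z > 0`:
`P_{μ₀}{|√N (τ̂^A_W − τ_W) · (√σ̂²_{A,N})⁻¹| ≤ z} → gaussianReal 0 1 (Icc (−z) z)` — the interval
`τ̂^A_W ± z σ̂_{A,N}/√N`, computed from the data alone, covers `τ_W` with probability tending to the nominal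
Gaussian level. -/
theorem tendsto_measure_chain_scorer_studentized_tauIntWindow_le_of_nHit (hπ : Kernel.Invariant κ π)
    (hε : ε ≠ 0) (hmin : ∀ z, ε • ν ≤ nHit κ m z) (hm : 0 < m)
    {f : S → ℝ} (hf : Measurable f) {C : ℝ} (hC : ∀ z, |f z| ≤ C)
    (hσ : autocov κ π (fun z => f z - ∫ z', f z' ∂π) 0 ≠ 0)
    (hpos : 0 < ∑ s : Fin (W + 1), ∑ t : Fin (W + 1),
        tauHatGrad W (toLp 2 fun u : Fin (W + 1) => autocov κ π (fun z => f z - ∫ z', f z' ∂π) u) s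
          * tauHatGrad W (toLp 2 fun u : Fin (W + 1) => autocov κ π (fun z => f z - ∫ z', f z' ∂π) u) t
          * chainLagACov κ π (fun z => f z - ∫ z', f z' ∂π) W s t)
    {K : ℕ → ℕ} (hK : Tendsto K atTop atTop) (hK3 : Tendsto (fun N => (K N : ℝ) ^ 3 / N) atTop (𝓝 0))
    (μ₀ : Measure S) [IsProbabilityMeasure μ₀] {z : ℝ} (hz : 0 < z)
    [IsProbabilityMeasure (Kernel.trajMeasure (X := fun _ : ℕ => S) μ₀
        (fun n : ℕ => κ.comap (fun hh : (i : ↥(Finset.Iic n)) → S => hh ⟨n, Finset.mem_Iic.2 le_rfl⟩)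
          (measurable_pi_apply _)))] :
    Tendsto (fun N : ℕ => (Kernel.trajMeasure (X := fun _ : ℕ => S) μ₀
        (fun n : ℕ => κ.comap (fun hh : (i : ↥(Finset.Iic n)) → S => hh ⟨n, Finset.mem_Iic.2 le_rfl⟩)
          (measurable_pi_apply _)))
        {x : ℕ → S | |Real.sqrt N
          * (tauIntWindow (rhoHat (fun i => f (x i)) N) W
            - tauIntWindow (fun t => autocov κ π (fun z => f z - ∫ z', f z' ∂π) t
                / autocov κ π (fun z => f z - ∫ z', f z' ∂π) 0) W)
          * (Real.sqrt (∑ s : Fin (W + 1), ∑ t : Fin (W + 1),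
            tauHatGrad W (toLp 2 fun u : Fin (W + 1) => gammaHat (fun j => f (x j)) N u) s
              * tauHatGrad W (toLp 2 fun u : Fin (W + 1) => gammaHat (fun j => f (x j)) N u) t
              * gammaCross
                  (fun i => (f (x i) - sampleMean (fun j => f (x j)) N)
                    * (f (x (i + s)) - sampleMean (fun j => f (x j)) N))
                  (fun i => (f (x i) - sampleMean (fun j => f (x j)) N)
                    * (f (x (i + t)) - sampleMean (fun j => f (x j)) N)) N (K N)))⁻¹| ≤ z})
      atTop (𝓝 (gaussianReal 0 1 (Icc (-z) z))) := by
  obtain ⟨hgm, hgC, -⟩ := centred_observable_bounds π hf hC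
  set σ2 := ∑ s : Fin (W + 1), ∑ t : Fin (W + 1),
      tauHatGrad W (toLp 2 fun u : Fin (W + 1) => autocov κ π (fun z => f z - ∫ z', f z' ∂π) u) s
        * tauHatGrad W (toLp 2 fun u : Fin (W + 1) => autocov κ π (fun z => f z - ∫ z', f z' ∂π) u) t
        * chainLagACov κ π (fun z => f z - ∫ z', f z' ∂π) W s t with hσ2
  obtain ⟨hZm, hZ⟩ := chain_gaussianLimit_realised κ W hπ hε hmin hm hgm hgC
  have hclt := tendstoInDistribution_chain_scorer_tauIntWindow_of_nHit κ hπ hε hmin hm hf hC W hσ μ₀ hZm hZ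
  have hY := hasLaw_chain_tauIntWindow_limit_quadForm κ W hπ hε hmin hm hgm hgC
    (toLp 2 fun t : Fin (W + 1) => autocov κ π (fun z => f z - ∫ z', f z' ∂π) t)
  rw [← hσ2] at hY
  have hB := chain_invSqrt_empTauIntVarHat_tendstoInMeasure_of_nHit κ W hπ hε hmin hm hf hC hσ hpos hK hK3 μ₀
  have hBm := fun N => (measurable_chain_empTauIntVarHat W hf N (K N)).sqrt.inv
  have h := tendsto_measure_abs_mul_le_of_clt_of_tendstoInMeasure hBm hY hclt hB hz
  have hb2 : NNReal.mk (((Real.sqrt σ2)⁻¹) ^ 2) (sq_nonneg _) * σ2.toNNReal = 1 := by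
    apply NNReal.eq
    rw [NNReal.coe_mul, NNReal.coe_mk, Real.coe_toNNReal _ hpos.le, NNReal.coe_one, inv_pow,
      Real.sq_sqrt hpos.le, inv_mul_cancel₀ hpos.ne']
  rw [hb2] at h
  exact h

/-- **One-step minorisation** (`κ(z, ·) ≥ ε ν`, the certificate shape of rows 8 / 9's samplers): the
same exact asymptotic coverage of the fully empirical studentised bar, `m = 1`. -/
theorem tendsto_measure_chain_scorer_studentized_tauIntWindow_le_of_minorised (hπ : Kernel.Invariant κ π)
    (hε : ε ≠ 0) (hmin : ∀ z, ε • ν ≤ κ z)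
    {f : S → ℝ} (hf : Measurable f) {C : ℝ} (hC : ∀ z, |f z| ≤ C)
    (hσ : autocov κ π (fun z => f z - ∫ z', f z' ∂π) 0 ≠ 0)
    (hpos : 0 < ∑ s : Fin (W + 1), ∑ t : Fin (W + 1),
        tauHatGrad W (toLp 2 fun u : Fin (W + 1) => autocov κ π (fun z => f z - ∫ z', f z' ∂π) u) s
          * tauHatGrad W (toLp 2 fun u : Fin (W + 1) => autocov κ π (fun z => f z - ∫ z', f z' ∂π) u) t
          * chainLagACov κ π (fun z => f z - ∫ z', f z' ∂π) W s t)
    {K : ℕ → ℕ} (hK : Tendsto K atTop atTop) (hK3 : Tendsto (fun N => (K N : ℝ) ^ 3 / N) atTop (𝓝 0))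
    (μ₀ : Measure S) [IsProbabilityMeasure μ₀] {z : ℝ} (hz : 0 < z)
    [IsProbabilityMeasure (Kernel.trajMeasure (X := fun _ : ℕ => S) μ₀
        (fun n : ℕ => κ.comap (fun hh : (i : ↥(Finset.Iic n)) → S => hh ⟨n, Finset.mem_Iic.2 le_rfl⟩)
          (measurable_pi_apply _)))] :
    Tendsto (fun N : ℕ => (Kernel.trajMeasure (X := fun _ : ℕ => S) μ₀
        (fun n : ℕ => κ.comap (fun hh : (i : ↥(Finset.Iic n)) → S => hh ⟨n, Finset.mem_Iic.2 le_rfl⟩)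
          (measurable_pi_apply _)))
        {x : ℕ → S | |Real.sqrt N
          * (tauIntWindow (rhoHat (fun i => f (x i)) N) W
            - tauIntWindow (fun t => autocov κ π (fun z => f z - ∫ z', f z' ∂π) t
                / autocov κ π (fun z => f z - ∫ z', f z' ∂π) 0) W)
          * (Real.sqrt (∑ s : Fin (W + 1), ∑ t : Fin (W + 1),
            tauHatGrad W (toLp 2 fun u : Fin (W + 1) => gammaHat (fun j => f (x j)) N u) s
              * tauHatGrad W (toLp 2 fun u : Fin (W + 1) => gammaHat (fun j => f (x j)) N u) t
              * gammaCross
                  (fun i => (f (x i) - sampleMean (fun j => f (x j)) N)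
                    * (f (x (i + s)) - sampleMean (fun j => f (x j)) N))
                  (fun i => (f (x i) - sampleMean (fun j => f (x j)) N)
                    * (f (x (i + t)) - sampleMean (fun j => f (x j)) N)) N (K N)))⁻¹| ≤ z})
      atTop (𝓝 (gaussianReal 0 1 (Icc (-z) z))) := by
  have hmin' : ∀ z, ε • ν ≤ nHit κ 1 z := fun z => by rw [nHit_one]; exact hmin z
  exact tendsto_measure_chain_scorer_studentized_tauIntWindow_le_of_nHit κ W hπ hε hmin' Nat.one_pos hf hC hσ
    hpos hK hK3 μ₀ hz

end Chain

end Summit.Ventures.LatticeQCDFlow.Scoring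

end
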